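import Summits.QuantumFields.BalabanUV.T4Continuum.Support.NE9ScalingDictionary

/-!
# NE9ScalingDictionaryWitness — NON-VACUITY of the scaled ↔ unscaled junction of `NE9ScalingDictionary` on a genuine
Gaussian block (row NE9, node U3, cell `pub-balaban`, rung (B)+1 on a finite T⁴; unit `b2b-balaban-t4-ne9-formalise-leaf-04`,
companion of `Support/NE9ScalingDictionary` v1, journal CLAIM l.5796 / PROPOSED l.6059)

HONEST FRAMING (T4-DAG PAGE 1).  Rung (B)+1 on a FIXED finite torus; NOT infinite volume, NOT the mass gap, NOT Clay.  NE9
is NOT PRINTED and NOT PROVED; nothing here concerns Bałaban's objects.  OUR OWN WORK (Summits side), [folklore] throughout;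
no printed statement is used or quoted as a hypothesis.

WHAT IS PROVED.  For ANY `A ≻ 0` the hypotheses of `NE9ScalingDictionary.formAct_couplingTwoPoint_of_insertion` are met by
the free Gaussian block on the box `K = [−1, 1]^ι` with unit density (`Φ = 0`) and purely quadratic action (`P = 0`):
* §1 `integral_exp_neg_quadForm` / `integrable_exp_neg_quadForm`: `∫ e^{−r·quadForm A} dx = ‖N_A(r)‖` and the real Gaussian
  weight is Lebesgue-integrable (`r > 0`) — read off the tree's complex normalisation `gaussNorm A r ≠ 0`;
  **`absAct_indicator_const_le`**: `absAct A volume (1_K·c) (quadForm A + 0) r ≤ ‖c‖` for every measurable `K` and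
  `r > 0` — the printed-TYPE bound of supplier (iv), uniform in the real coupling, holds with `N = ‖c‖`;
* §2 the box block: finite volume, `|quadForm A| ≤ ½ΣΣ|A i j|` and `quadForm A ≥ 0` on it, and its scaled cut-off
  `scaledCut K s = [−s⁻¹, s⁻¹]^ι` MOVES with the coupling (`scaledCut_boxBlock`);
* §3 **`box_formAct_couplingTwoPoint`**: for `s, s′ ∈ ]0, γ]`, `0 < θ < 1`:
  `‖formAct (gaussRef A) (scaledCut K) 1 (scaledExp 0 0) s‖ ≤ 1 ∧ ‖… s − … s′‖ ≤ (K(θ,n)/γ⁻²)·1·|s⁻² − s′⁻²|`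
  — the junction's conclusion on concrete data with every hypothesis DISCHARGED (no binder left), i.e. the junction is
  inhabited by a genuine `n`-dimensional Gaussian integral with a coupling-dependent cut-off, not by a degenerate instance.
Kernel inputs BY NAME: `NE9ScalingDictionary` (this unit), `T4ComplexDilation.gaussNorm_ne_zero`,
`NE9BirthCouplingTwoPoint.birthConst`, Mathlib (`Integrable.of_integral_ne_zero`, `integral_mono_of_nonneg`,
`Real.volume_Icc_pi`); modifies nothing.
-/

noncomputable section

namespace Summit.QuantumFields.BalabanUV.T4Continuum.NE9ScalingDictionaryWitness

open MeasureTheory Complex Set Matrix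
open scoped NNReal ENNReal
open Literature.MathematicalPhysics.QuantumFieldTheory.Balaban1983to89.T4ComplexDilation
open Summit.QuantumFields.BalabanUV.T4Continuum.NE9BirthCouplingTwoPoint
open Summit.QuantumFields.BalabanUV.T4Continuum.NE9CouplingTwoPoint (formAct)
open Summit.QuantumFields.BalabanUV.T4Continuum.NE9ScalingDictionary

variable {ι : Type*} [Fintype ι] [DecidableEq ι]

/-! ## §1 The real Gaussian weight: integral, integrability, and the uniform bound on `absAct` -/

omit [DecidableEq ι] in
/-- The complex normalisation at a real coupling is the real Gaussian integral of the quadratic action: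
`N_A(r) = ↑(∫ e^{−r·quadForm A x} dx)`. [folklore] -/
theorem gaussNorm_ofReal_eq_integral (A : Matrix ι ι ℝ) (r : ℝ) :
    gaussNorm A (r : ℂ) = ((∫ x : ι → ℝ, Real.exp (-(r * quadForm A x)) : ℝ) : ℂ) := by
  unfold gaussNorm
  rw [← integral_complex_ofReal]
  refine integral_congr_ae (Filter.Eventually.of_forall fun x => ?_)
  simp only [quadForm]
  rw [Complex.ofReal_exp]
  congr 1
  push_cast
  ring

omit [DecidableEq ι] in
/-- **`∫ e^{−r·quadForm A} dx = ‖N_A(r)‖`** (any real `r`; both sides vanish together when the weight is not integrable).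
[folklore] -/
theorem integral_exp_neg_quadForm (A : Matrix ι ι ℝ) (r : ℝ) :
    ∫ x : ι → ℝ, Real.exp (-(r * quadForm A x)) = ‖gaussNorm A (r : ℂ)‖ := by
  rw [gaussNorm_ofReal_eq_integral, Complex.norm_real,
    Real.norm_of_nonneg (integral_nonneg fun x => (Real.exp_pos _).le)]

/-- The real Gaussian weight `e^{−r·quadForm A}` is Lebesgue-integrable (`A ≻ 0`, `r > 0`): its complex version has the
non-zero integral `N_A(r)` (`T4ComplexDilation.gaussNorm_ne_zero`), and a non-integrable function integrates to `0`.
[folklore] -/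
theorem integrable_exp_neg_quadForm (A : Matrix ι ι ℝ) (hA : A.PosDef) {r : ℝ} (hr : 0 < r) :
    Integrable (fun x : ι → ℝ => Real.exp (-(r * quadForm A x))) volume := by
  have hre : 0 < ((r : ℝ) : ℂ).re := by simpa using hr
  have hne : gaussNorm A (r : ℂ) ≠ 0 := gaussNorm_ne_zero A hA hre
  rw [gaussNorm_ofReal_eq_integral] at hne
  have hne' : ∫ x : ι → ℝ, Real.exp (-(r * quadForm A x)) ≠ 0 := fun h => hne (by rw [h]; simp)
  exact Integrable.of_integral_ne_zero hne'

omit [DecidableEq ι] in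
/-- Pointwise: the cut-off density of constant value `c` under the Boltzmann weight is dominated by `‖c‖` times the
weight. [folklore] -/
theorem norm_indicator_const_mul_le (K : Set (ι → ℝ)) (c : ℂ) (A : Matrix ι ι ℝ) (r : ℝ) (x : ι → ℝ) :
    ‖K.indicator (fun _ => c) x‖ * Real.exp (-(r * (quadForm A x + 0))) ≤ ‖c‖ * Real.exp (-(r * quadForm A x)) := by
  rw [add_zero]
  refine mul_le_mul_of_nonneg_right ?_ (Real.exp_pos _).le
  exact norm_indicator_le_norm_self _ _

/-- **THE PRINTED-TYPE BOUND OF SUPPLIER (iv) HOLDS ON THE FREE BLOCK**: for every cut-off set `K`, constant density `c`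
and real coupling `r > 0`, `absAct A volume (1_K·c) (quadForm A + 0) r ≤ ‖c‖` — uniformly in `r` (the normalisation
`‖N_A(r)‖⁻¹` exactly compensates the Gaussian volume). [folklore] -/
theorem absAct_indicator_const_le (A : Matrix ι ι ℝ) (hA : A.PosDef) (K : Set (ι → ℝ)) (c : ℂ) {r : ℝ}
    (hr : 0 < r) :
    absAct A volume (K.indicator fun _ => c) (fun x => quadForm A x + 0) r ≤ ‖c‖ := by
  have hre : 0 < ((r : ℝ) : ℂ).re := by simpa using hr
  have hN : 0 < ‖gaussNorm A (r : ℂ)‖ := norm_pos_iff.2 (gaussNorm_ne_zero A hA hre)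
  have hint : Integrable (fun x : ι → ℝ => ‖c‖ * Real.exp (-(r * quadForm A x))) volume :=
    (integrable_exp_neg_quadForm A hA hr).const_mul _
  have hmono : ∫ x : ι → ℝ, ‖K.indicator (fun _ => c) x‖ * Real.exp (-(r * (quadForm A x + 0))) ≤
      ∫ x : ι → ℝ, ‖c‖ * Real.exp (-(r * quadForm A x)) :=
    integral_mono_of_nonneg (Filter.Eventually.of_forall fun x => by positivity) hint
      (Filter.Eventually.of_forall fun x => norm_indicator_const_mul_le K c A r x)
  rw [integral_const_mul, integral_exp_neg_quadForm A r] at hmono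
  unfold absAct
  calc ‖gaussNorm A (r : ℂ)‖⁻¹ * ∫ x : ι → ℝ, ‖K.indicator (fun _ => c) x‖ * Real.exp (-(r * (quadForm A x + 0)))
      ≤ ‖gaussNorm A (r : ℂ)‖⁻¹ * (‖c‖ * ‖gaussNorm A (r : ℂ)‖) :=
        mul_le_mul_of_nonneg_left hmono (inv_nonneg.2 hN.le)
    _ = ‖c‖ := by field_simp

/-! ## §2 The box block `[−1, 1]^ι` -/

/-- The box block `K = [−1, 1]^ι` (a model small-field cut-off `|x i| ≤ 1` in the unscaled variables). [folklore] -/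
def boxBlock : Set (ι → ℝ) := Set.Icc (fun _ => (-1 : ℝ)) (fun _ => 1)

omit [Fintype ι] [DecidableEq ι] in
/-- Coordinates on the box are bounded by `1` in absolute value. [folklore] -/
theorem abs_le_one_of_mem_boxBlock {x : ι → ℝ} (hx : x ∈ (boxBlock : Set (ι → ℝ))) (i : ι) : |x i| ≤ 1 :=
  abs_le.2 ⟨hx.1 i, hx.2 i⟩

omit [DecidableEq ι] in
/-- The box block has finite Lebesgue volume (`2^n`). [folklore] -/
theorem volume_boxBlock_ne_top : volume (boxBlock : Set (ι → ℝ)) ≠ ∞ := by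
  unfold boxBlock
  rw [Real.volume_Icc_pi]
  exact ENNReal.prod_ne_top fun i _ => ENNReal.ofReal_ne_top

omit [DecidableEq ι] in
/-- The unit density cut off to the box is Lebesgue-integrable (in the junction's letters: `Φ = 0`, density
`1_K·e^{0}`). [folklore] -/
theorem integrable_indicator_boxBlock :
    Integrable ((boxBlock : Set (ι → ℝ)).indicator fun x => cexp ((fun _ : ι → ℝ => (0 : ℂ)) x)) volume :=
  (integrableOn_const (volume_boxBlock_ne_top (ι := ι))).integrable_indicator measurableSet_Icc

omit [DecidableEq ι] in
/-- The quadratic action is bounded on the box: `|quadForm A x| ≤ ½·Σ_i Σ_j |A i j|`. [folklore] -/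
theorem abs_quadForm_le_of_mem_boxBlock (A : Matrix ι ι ℝ) {x : ι → ℝ} (hx : x ∈ (boxBlock : Set (ι → ℝ))) :
    |quadForm A x + 0| ≤ (1 / 2) * ∑ i, ∑ j, |A i j| := by
  rw [add_zero, quadForm, abs_mul, abs_of_pos (by norm_num : (0 : ℝ) < 1 / 2)]
  refine mul_le_mul_of_nonneg_left ?_ (by norm_num)
  have hxi := abs_le_one_of_mem_boxBlock hx
  simp only [dotProduct, Matrix.mulVec]
  refine (Finset.abs_sum_le_sum_abs _ _).trans (Finset.sum_le_sum fun i _ => ?_)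
  rw [abs_mul]
  refine (mul_le_mul_of_nonneg_right (hxi i) (abs_nonneg _)).trans ?_
  rw [one_mul]
  refine (Finset.abs_sum_le_sum_abs _ _).trans (Finset.sum_le_sum fun j _ => ?_)
  rw [abs_mul]
  calc |A i j| * |x j| ≤ |A i j| * 1 := mul_le_mul_of_nonneg_left (hxi j) (abs_nonneg _)
    _ = |A i j| := mul_one _

omit [DecidableEq ι] in
/-- The quadratic action of `A ≻ 0` is non-negative (everywhere, in particular on the box). [folklore] -/
theorem quadForm_nonneg (A : Matrix ι ι ℝ) (hA : A.PosDef) (x : ι → ℝ) : 0 ≤ quadForm A x + 0 := by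
  rw [add_zero, quadForm]
  have h := hA.posSemidef.dotProduct_mulVec_nonneg x
  rw [star_trivial] at h
  positivity

omit [Fintype ι] [DecidableEq ι] in
/-- THE CUT-OFF MOVES: the scaled cut-off of the box at coupling `s > 0` is the box of half-side `s⁻¹`,
`scaledCut K s = [−s⁻¹, s⁻¹]^ι` (the model of the scaled threshold `ε₁g_k⁻¹` with `ε₁ = 1`, `g_k = s`). [folklore] -/
theorem scaledCut_boxBlock {s : ℝ} (hs : 0 < s) :
    scaledCut (boxBlock : Set (ι → ℝ)) s = Set.Icc (fun _ => -s⁻¹) (fun _ => s⁻¹) := by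
  ext y
  simp only [mem_scaledCut, boxBlock, Set.mem_Icc, Pi.le_def, Pi.smul_apply, smul_eq_mul]
  have h1 : ∀ i, (-1 ≤ s * y i ↔ -s⁻¹ ≤ y i) := fun i => by
    rw [inv_eq_one_div, ← neg_div, div_le_iff₀ hs, mul_comm]
  have h2 : ∀ i, (s * y i ≤ 1 ↔ y i ≤ s⁻¹) := fun i => by
    rw [inv_eq_one_div, le_div_iff₀ hs, mul_comm]
  simp only [h1, h2]

/-! ## §3 The junction inhabited -/

/-- **NON-VACUITY OF THE JUNCTION**: on the free Gaussian block cut off to the box `[−1,1]^ι` (any `A ≻ 0`, unit density,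
purely quadratic action) EVERY hypothesis of `NE9ScalingDictionary.formAct_couplingTwoPoint_of_insertion` is discharged,
so for all `0 < θ < 1`, `γ > 0` and couplings `s, s′ ∈ ]0, γ]` the scaled cut-off form with the moving box `[−s⁻¹, s⁻¹]^ι`
obeys the coupling two-point clause in t-currency with `N = 1`, `clip = K(θ,n)/γ⁻²`. [folklore] -/
theorem box_formAct_couplingTwoPoint (A : Matrix ι ι ℝ) (hA : A.PosDef) {θ : ℝ} (hθ : 0 < θ) (hθ1 : θ < 1)
    {γ : ℝ} (hγ : 0 < γ) {s s' : ℝ} (hs : s ∈ Ioc 0 γ) (hs' : s' ∈ Ioc 0 γ) :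
    ‖formAct (gaussRef A) (scaledCut boxBlock) (fun _ => 1)
        (scaledExp (fun _ : ι → ℝ => (0 : ℂ)) (fun _ => (0 : ℝ))) s‖ ≤ 1 ∧
      ‖formAct (gaussRef A) (scaledCut boxBlock) (fun _ => 1)
            (scaledExp (fun _ : ι → ℝ => (0 : ℂ)) (fun _ => (0 : ℝ))) s -
          formAct (gaussRef A) (scaledCut boxBlock) (fun _ => 1)
            (scaledExp (fun _ : ι → ℝ => (0 : ℂ)) (fun _ => (0 : ℝ))) s'‖ ≤
        birthConst θ (Fintype.card ι) / (γ⁻¹) ^ 2 * 1 * |(s⁻¹) ^ 2 - (s'⁻¹) ^ 2| := by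
  have hS₀0 : (0 : ℝ) ≤ (1 / 2) * ∑ i, ∑ j, |A i j| := by positivity
  have habs : ∀ r, (1 - θ) * (γ⁻¹) ^ 2 ≤ r →
      absAct A volume ((boxBlock : Set (ι → ℝ)).indicator fun x => cexp ((fun _ : ι → ℝ => (0 : ℂ)) x))
        (fun x => quadForm A x + (fun _ : ι → ℝ => (0 : ℝ)) x) r ≤ 1 := by
    intro r hr
    have hr0 : 0 < r := lt_of_lt_of_le (mul_pos (by linarith) (by positivity)) hr
    have h := absAct_indicator_const_le A hA boxBlock (cexp 0) hr0
    have h1 : ‖cexp (0 : ℂ)‖ = 1 := by simp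
    rw [h1] at h
    exact h
  exact formAct_couplingTwoPoint_of_insertion A hA measurableSet_Icc integrable_indicator_boxBlock
    (P := fun _ => (0 : ℝ)) measurable_const hS₀0 (fun x hx => abs_quadForm_le_of_mem_boxBlock A hx)
    (fun x _ => quadForm_nonneg A hA x) hθ hθ1 hγ habs hs hs'

end Summit.QuantumFields.BalabanUV.T4Continuum.NE9ScalingDictionaryWitness

end
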